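import Summits.CriticalPhenomena.PercolationContinuityZ3.Theorems.Transplant.KNLevelsKitsForced
import Summits.CriticalPhenomena.PercolationContinuityZ3.Theorems.Transplant.KNLevelsTargetLemmaAdditive
import HarnessLib

/-!
# F6/F7 (generic), (S0) kit tier part 2 — Kozma–Nitzan's STEP V, Lemma 10 and the source-additive target property OVER THE RELAY CLAUSE,
# unconditionally; the additive chain estimates a closure consumes (N2-SCOPE §19.1 (d); T4-S0 v1.1 §5 — (O4) dissolved)

builds on p205010 (kernel theorem, internal audit signed; external expert review pending) through `additiveGluingSchema_KN_in` (part 6,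
from `AdditiveGluing_proof`), exactly as part 7b does.  Lane `prim-bschramm`, seat `prim-bschramm-p1` (gen 16; (S0) kit tier, WAVE 0 (d));
helper file (`--supports stmt-CriticalPhenomena-4575`).  Nothing here is a claim about the open node `SamePDropOfSkeletonFrm₁`.

* **`LHyp.stepV_additiveF`** — Step V in source-additive form from the RELAY CLAUSE (part 1, `KNLevels.RelayClause`) instead of
  (seeds off `E(S)` + Step-IV face estimate): `P_W(≥ N contacts at level j) − 5δ ≤ P_W(o ↔ T)`.  Proof = part 7a's `LHyp.stepV_additive`
  with Claim D COLLAPSED: `Σ_P P([P]) φ_P = ` the total-probability expansion of `P(⋃_x oSeed_x ∩ Good_x)` pattern by pattern, since on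
  `oSeed_x ∩ Good_x ∩ [P]_{E(S)}` the source is joined to a face vertex that is a good relay of the pattern `P` (no `hFx_pin`, no factorisation);
* `targetLemma_additive_of_kitsF` — Steps I–V assembled: `P_W(o ↔ T) ≥ P_W(o ↔ B⟨0⟩) − 6δ` from (S0)-shape kits and the additive schema;
* **`additiveTargetPropertyUF_KN : AdditiveTargetPropertyUF V Δ`** (`C = 6`), every countable `V` — unconditional;
* `chain_edge_additive_F_KN`, `chain_edge_from_source_F_KN` — the additive chain estimates over `TStep.KitsAtF` (the form a closure consumes).
[cite: KozmaNitzan2024, §4 Lemma 10 (pp. 17–22), Lemma 11 (p. 22), Lemma 12 (pp. 23–25); Conjecture 1 (p. 3)] [this work]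
-/

noncomputable section

open MeasureTheory ProbabilityTheory
open scoped ENNReal

namespace Summit.CriticalPhenomena.PercolationContinuityZ3.Theorems

namespace Transplant

namespace KNLevels

open Literature.Probability.Percolation Literature.Probability.LatticeModels SimpleGraph

variable {V : Type} [DecidableEq V] {G : SimpleGraph V} [G.LocallyFinite]

namespace LHyp

variable {L : LData G} {W : Sym2 V → unitInterval} {p : unitInterval} {D : Finset V} {R : ℕ}
variable (hL : LHyp L W p D R)
include hL

open Classical in
/-- **Step V, source-additive, from the RELAY CLAUSE** (KN pp. 21–22 with the additive gluing inequality in every pinned weighting `K_ξ`):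
at a level `j ≤ R` with seed data `σ` (Step-III axioms, `(1 − p^{sB})^k ≤ δ`), a shell `S ⊆ D` containing the faces, the relay clause at
accuracy `δ` (part 1) and the ADDITIVE gluing schema for finitely supported weightings with source `o`, target `T` and `D`-reliable relays:
`P_W(≥ N contacts at level j) − 5δ ≤ P_W(o ↔ T)`. [cite: KozmaNitzan2024, §4 pp. 21–22 (Step V, (26))] [this work] -/
theorem stepV_additiveF [Countable V] {σ : SData V} {j : ℕ} (hσ : SHyp L j σ) (hj : j ≤ R)
    {S T : Finset V} (hSD : S ⊆ D) {δ : ℝ} (hδ : 0 ≤ δ)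
    (hIII : (1 - (p : ℝ) ^ σ.sB) ^ σ.k ≤ δ)
    (hUS : ∀ x ∈ σ.K, σ.face x ⊆ S)
    (hV : RelayClause L W j σ S T D δ)
    (hAG : ∀ (w : Sym2 V → unitInterval), FinSupp w L.Sfin → ∀ (A : Finset V), A ⊆ L.Sfin → ∀ t : ℝ, 0 ≤ t →
      (∀ a ∈ A, 1 - t ≤ (prodBernoulli w).real (⋃ t' ∈ T, openConnIn (↑D : Set V) a t')) →
      (prodBernoulli w).real (⋃ a ∈ A, openConn L.o a) - t ≤ (prodBernoulli w).real (⋃ t' ∈ T, openConn L.o t')) :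
    (prodBernoulli W).real (L.Fail σ.N j)ᶜ - 5 * δ ≤ (prodBernoulli W).real (⋃ t ∈ T, openConn L.o t) := by
  set μ := prodBernoulli W with hμ
  set F := pairsF S with hF
  have hFS : (↑F : Set (Sym2 V)) = wireSet (↑S : Set V) := coe_pairsF S
  have hSfin : S ⊆ L.Sfin := hSD.trans hL.DS
  -- the good sets `A_ξ` and the quantities `φ_ξ`
  set Aof : Finset (Sym2 V) → Finset V := fun P => S.filter fun u =>
    1 - δ < (prodBernoulli (pinW W (wireSet (↑S : Set V)) ↑P)).real (⋃ t ∈ T, openConnIn (↑D : Set V) u t) with hAof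
  set φ : Finset (Sym2 V) → ℝ := fun P =>
    (prodBernoulli (pinW W ↑F ↑P)).real (⋃ a ∈ Aof P, openConn L.o a) with hφ
  set cyl : Finset (Sym2 V) → Set (BondConfig V) := fun P => localCylinder ↑F ↑P with hcyl
  -- `μ(≥ N contacts ∧ 𝒢) ≥ μ(≥ N contacts) − δ` — (19), additively
  have hG : μ.real (L.Fail σ.N j)ᶜ - δ ≤ μ.real ((L.Fail σ.N j)ᶜ ∩ L.Gev σ j) := by
    have hmG : MeasurableSet (L.Gev σ j) := LData.measurableSet_Gev j
    have h1 := hL.real_manyContacts_diff_Gev_le hσ hj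
    have h2 : μ.real (L.Fail σ.N j)ᶜ = μ.real ((L.Fail σ.N j)ᶜ ∩ L.Gev σ j) + μ.real ((L.Fail σ.N j)ᶜ \ L.Gev σ j) :=
      (measureReal_inter_add_sdiff (s := (L.Fail σ.N j)ᶜ) hmG).symm
    linarith
  -- Claim D, collapsed: `μ(Failᶜ ∩ 𝒢) − 3δ ≤ μ(⋃ oSeed_x ∩ Good_x) ≤ Σ_P μ(cyl P) φ(P)`
  set E : Set (BondConfig V) := ⋃ x ∈ σ.K, (L.oSeed σ j x ∩ GoodFace W σ S T D δ x) with hE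
  have hEm : MeasurableSet E :=
    Finset.measurableSet_biUnion _ fun x _ => (LData.measurableSet_oSeed j x).inter (measurableSet_goodFace W σ S T D δ x)
  have hEcyl : ∀ P, P ⊆ F → (prodBernoulli (pinW W ↑F ↑P)).real E ≤ φ P := by
    intro P _
    refine prodBernoulli_pinW_real_mono_of_inter W (F.finite_toSet.countable) ↑P fun ω ⟨hωE, hωc⟩ => ?_
    simp only [hE, Set.mem_iUnion, Set.mem_inter_iff, exists_prop] at hωE
    obtain ⟨x, hx, hseed, u, hu, hgood⟩ := hωE
    -- the pinned law of `ω` is the pinned law of the pattern `P`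
    have hag : ∀ e ∈ wireSet (↑S : Set V), e ∈ ω ↔ e ∈ (↑P : Set (Sym2 V)) := fun e he =>
      hωc e (by rw [hFS]; exact he)
    rw [pinW_congr W hag] at hgood
    have huA : u ∈ Aof P := Finset.mem_filter.2 ⟨hUS x hx hu, hgood⟩
    simp only [Set.mem_iUnion, exists_prop]
    exact ⟨u, huA, LData.openConn_of_mem_oSeed hσ hseed hu⟩
  have hD : μ.real ((L.Fail σ.N j)ᶜ ∩ L.Gev σ j) - 3 * δ ≤ ∑ P ∈ F.powerset, μ.real (cyl P) * φ P := by
    have hV' : μ.real ((L.Fail σ.N j)ᶜ ∩ L.Gev σ j) - 3 * δ ≤ μ.real E := hV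
    have htot := prodBernoulli_real_inter_eq_sum_pinW W F hEm (determinedBy_univ (↑F : Set (Sym2 V)))
    rw [Set.inter_univ] at htot
    simp only [Set.mem_univ, Finset.filter_true] at htot
    rw [hμ] at hV' ⊢
    rw [htot] at hV'
    refine hV'.trans (Finset.sum_le_sum fun P hP => ?_)
    exact mul_le_mul_of_nonneg_left (hEcyl P (Finset.mem_powerset.1 hP)) measureReal_nonneg
  -- total mass of the cylinders is `1`
  have hcyl_sum : ∑ P ∈ F.powerset, μ.real (cyl P) = 1 := by
    have := prodBernoulli_real_eq_sum_localCylinder W F (determinedBy_univ (↑F : Set (Sym2 V)))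
    rw [probReal_univ] at this
    rw [hμ, this]
    refine (Finset.sum_congr ?_ fun P _ => rfl)
    ext P; simp
  -- Claim F, additive: in EVERY pinned weighting the additive gluing schema gives `φ(P) − δ ≤ P_{K_P}(o ↔ T)`
  have hF' : ∀ P ∈ F.powerset, φ P - δ ≤ (prodBernoulli (pinW W ↑F ↑P)).real (⋃ t ∈ T, openConn L.o t) := by
    intro P _
    have hsupp : FinSupp (pinW W ↑F ↑P) L.Sfin :=
      hL.fin.pinW (F := (↑F : Set (Sym2 V))) ↑P
        (by rw [hFS]; exact KozmaNitzan.wireSet_mono (Finset.coe_subset.2 hSfin))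
    refine hAG _ hsupp (Aof P) ((Finset.filter_subset _ _).trans hSfin) δ hδ fun a ha => ?_
    have hga := (Finset.mem_filter.1 ha).2
    rw [← hFS] at hga
    exact hga.le
  -- conclusion: total probability over the patterns
  have hmT : MeasurableSet (⋃ t ∈ T, openConn L.o t : Set (BondConfig V)) :=
    Finset.measurableSet_biUnion _ fun t _ => measurableSet_openConn_holds _ _
  have htot := prodBernoulli_real_inter_eq_sum_pinW W F hmT (determinedBy_univ (↑F : Set (Sym2 V)))
  rw [Set.inter_univ] at htot
  simp only [Set.mem_univ, Finset.filter_true] at htot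
  rw [hμ] at hG hD hcyl_sum
  rw [htot]
  calc (prodBernoulli W).real (L.Fail σ.N j)ᶜ - 5 * δ
      ≤ ((prodBernoulli W).real ((L.Fail σ.N j)ᶜ ∩ L.Gev σ j) - 3 * δ) - δ := by linarith
    _ ≤ ∑ P ∈ F.powerset, (prodBernoulli W).real (cyl P) * φ P - δ * ∑ P ∈ F.powerset, (prodBernoulli W).real (cyl P) := by
        rw [hcyl_sum, mul_one]; linarith
    _ = ∑ P ∈ F.powerset, (prodBernoulli W).real (cyl P) * (φ P - δ) := by
        rw [Finset.mul_sum, ← Finset.sum_sub_distrib]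
        refine Finset.sum_congr rfl fun P _ => by ring
    _ ≤ ∑ P ∈ F.powerset, (prodBernoulli W).real (cyl P) *
          (prodBernoulli (pinW W ↑F ↑P)).real (⋃ t ∈ T, openConn L.o t) :=
        Finset.sum_le_sum fun P hP => mul_le_mul_of_nonneg_left (hF' P hP) measureReal_nonneg

end LHyp

/-! ## §2 Lemma 10 assembled over (S0)-shape kits, source-additive -/

/-- **Kozma–Nitzan's Lemma 10 over the levels of `G`, SOURCE-ADDITIVE, from per-level (S0)-shape kits** (Steps I–V; the graph-free skeleton of
KN pp. 17–22 with the RELAY CLAUSE at every level of the window and the ADDITIVE gluing schema): `P_W(o ↔ T) ≥ P_W(o ↔ B⟨0⟩) − 6δ` — no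
hypothesis on the source. [cite: KozmaNitzan2024, §4 Lemma 10 (pp. 17–22)] [this work] -/
theorem targetLemma_additive_of_kitsF [Countable V] {Δ : ℕ} (hΔ : ∀ x, G.degree x ≤ Δ)
    (hAG : ∀ (w : Sym2 V → unitInterval) (Sf : Finset V), (∀ e : Sym2 V, (∃ x ∈ e, x ∉ Sf) → w e = 0) →
      ∀ (A T : Finset V) (o : V) (Rg : Set V) (t : ℝ), A ⊆ Sf → T ⊆ Sf → o ∈ Sf → T.Nonempty → 0 ≤ t →
        (∀ a ∈ A, 1 - t ≤ (prodBernoulli w).real (⋃ t' ∈ T, openConnIn Rg a t')) →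
          (prodBernoulli w).real (⋃ a ∈ A, openConn o a) - t ≤ (prodBernoulli w).real (⋃ t' ∈ T, openConn o t'))
    (p : unitInterval) (hp1 : (p : ℝ) < 1) {δ : ℝ} (hδ : 0 ≤ δ)
    (L : LData G) (W : Sym2 V → unitInterval) (D T : Finset V) (R N j₀ j₁ : ℕ)
    (hL : LHyp L W p D R) (hj : j₁ ≤ R) (hTD : T ⊆ D) (hTne : T.Nonempty)
    (hJ : 1 / (1 - (p : ℝ)) ^ (Δ * N) ≤ δ * ((Finset.Icc j₀ j₁).card : ℝ))
    (hkits : ∀ j ∈ Finset.Icc j₀ j₁, ∃ (σ : SData V) (S : Finset V), SHyp L j σ ∧ σ.N ≤ N ∧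
      (1 - (p : ℝ) ^ σ.sB) ^ σ.k ≤ δ ∧ S ⊆ D ∧ (∀ x ∈ σ.K, σ.face x ⊆ S) ∧ RelayClause L W j σ S T D δ) :
    (prodBernoulli W).real L.reachB - 6 * δ ≤ (prodBernoulli W).real (⋃ t ∈ T, openConn L.o t) := by
  -- Step II: the level
  obtain ⟨j, hjJ, hII⟩ := hL.stepII_additive hΔ hp1 hj hJ
  have hjR : j ≤ R := (Finset.mem_Icc.1 hjJ).2.trans hj
  obtain ⟨σ, S, hσ, hN, hIII, hSD, hUS, hV⟩ := hkits j hjJ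
  -- Step II's output in the `Fail` form for `σ.N ≤ N`
  have hII' : (prodBernoulli W).real L.reachB - δ ≤ (prodBernoulli W).real (L.Fail σ.N j)ᶜ := by
    refine hII.trans (measureReal_mono (fun ω hω => ?_) (measure_ne_top _ _))
    rw [LData.compl_Fail_eq]
    exact hN.trans hω
  -- the additive gluing schema in the required form: source `o`, relays reliable to `T` inside `D`
  have hAG' : ∀ (w : Sym2 V → unitInterval), FinSupp w L.Sfin → ∀ (A : Finset V), A ⊆ L.Sfin → ∀ t : ℝ, 0 ≤ t →
      (∀ a ∈ A, 1 - t ≤ (prodBernoulli w).real (⋃ t' ∈ T, openConnIn (↑D : Set V) a t')) →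
      (prodBernoulli w).real (⋃ a ∈ A, openConn L.o a) - t ≤ (prodBernoulli w).real (⋃ t' ∈ T, openConn L.o t') :=
    fun w hw A hA t ht haT => hAG w L.Sfin hw.zero A T L.o (↑D : Set V) t hA (hTD.trans hL.DS) hL.o_mem hTne ht haT
  -- Steps III–V, additive, over the relay clause
  have hV := hL.stepV_additiveF hσ hjR hSD hδ hIII hUS hV hAG'
  linarith

/-! ## §3 The source-additive target property over (S0)-shape kits, unconditionally; the additive chain estimates -/

/-- **The (S0)-shape source-additive target property from the additive gluing schema** (`C = 6`). [cite: KozmaNitzan2024, §4 Lemma 10 (pp. 17–22)]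
[this work] -/
theorem additiveTargetPropertyUF_of_schema [Countable V] {Δ : ℕ}
    (hAG : ∀ (w : Sym2 V → unitInterval) (Sf : Finset V), (∀ e : Sym2 V, (∃ x ∈ e, x ∉ Sf) → w e = 0) →
      ∀ (A T : Finset V) (o : V) (Rg : Set V) (t : ℝ), A ⊆ Sf → T ⊆ Sf → o ∈ Sf → T.Nonempty → 0 ≤ t →
        (∀ a ∈ A, 1 - t ≤ (prodBernoulli w).real (⋃ t' ∈ T, openConnIn Rg a t')) →
          (prodBernoulli w).real (⋃ a ∈ A, openConn o a) - t ≤ (prodBernoulli w).real (⋃ t' ∈ T, openConn o t')) :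
    AdditiveTargetPropertyUF V Δ := by
  refine ⟨6, by norm_num, fun δ hδ _ p hp1 G _ hΔ L W D T R N j₀ j₁ hL hj hTD hTne hJ hkits => ?_⟩
  exact targetLemma_additive_of_kitsF hΔ hAG p hp1 hδ.le L W D T R N j₀ j₁ hL hj hTD hTne hJ hkits

/-- **THE (S0)-SHAPE SOURCE-ADDITIVE TARGET PROPERTY, UNCONDITIONALLY** (every countable vertex type, every degree bound `Δ`; `C = 6`) — from the
tree theorem `AdditiveGluing_proof` via `additiveGluingSchema_KN_in`.  builds on p205010 (kernel theorem, internal audit signed; external expert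
review pending). [cite: KozmaNitzan2024, §4 Lemma 10 (pp. 17–22); Conjecture 1 (p. 3)] [this work] -/
theorem additiveTargetPropertyUF_KN [Countable V] {Δ : ℕ} : AdditiveTargetPropertyUF V Δ :=
  additiveTargetPropertyUF_of_schema fun w Sf hw A T o Rg t hA hT ho hne ht haT =>
    additiveGluingSchema_KN_in w Sf hw A T o Rg t hA hT ho hne ht haT

/-- **The unconditional ADDITIVE CHAIN ESTIMATE over (S0)-shape kits** (the form the N2 closure consumes): for every `n`, every kit accuracy
`δ ∈ (0, 1]`, every `p < 1`, every graph on `V` with degrees `≤ Δ`, every weighting and every linked chain of `n + 1` target steps with true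
targets `T'_i ⊆ T_i`, (S0)-kits at `δ` and excess `P_W(o ↔ T_i \ T'_i) ≤ η`: `P_W(o ↔ X_0(0)) − (n + 1)(6δ + η) ≤ P_W(o ↔ T'_n)`.
builds on p205010 (kernel theorem, internal audit signed; external expert review pending).
[cite: KozmaNitzan2024, §4 Lemma 11 (p. 22), Lemma 12 (pp. 23–25)] [this work] -/
theorem chain_edge_additive_F_KN [Countable V] {Δ : ℕ} :
    ∃ C : ℝ, 0 ≤ C ∧ ∀ (n : ℕ) ⦃δ : ℝ⦄, 0 < δ → δ ≤ 1 → ∀ (p : unitInterval), (p : ℝ) < 1 →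
      ∀ (G : SimpleGraph V) [G.LocallyFinite], (∀ x, G.degree x ≤ Δ) →
      ∀ (W : Sym2 V → unitInterval) (s : Fin (n + 1) → TStep G) (T' : Fin (n + 1) → Finset V) (η : ℝ),
      (∀ i : Fin (n + 1), (s i).L.o = (s 0).L.o) →
      (∀ i : Fin n, T' (Fin.castSucc i) ⊆ (s i.succ).L.X 0) →
      (∀ i : Fin (n + 1), T' i ⊆ (s i).T) →
      (∀ i : Fin (n + 1), (s i).KitsAtF W p Δ δ) →
      (∀ i : Fin (n + 1), (prodBernoulli W).real (⋃ t ∈ (s i).T \ T' i, openConn (s 0).L.o t) ≤ η) →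
        (prodBernoulli W).real (s 0).L.reachB - (n + 1 : ℕ) * (C * δ + η) ≤
          (prodBernoulli W).real (⋃ t ∈ T' (Fin.last n), openConn (s 0).L.o t) :=
  (additiveTargetPropertyUF_KN (V := V) (Δ := Δ)).chain_edge_additive

/-- The same in the `1 − ε` shape: source at `1 − δs`, conclusion at `1 − (δs + (n+1)(Cδ + η))`. [this work] -/
theorem chain_edge_from_source_F_KN [Countable V] {Δ : ℕ} :
    ∃ C : ℝ, 0 ≤ C ∧ ∀ (n : ℕ) ⦃δ : ℝ⦄, 0 < δ → δ ≤ 1 → ∀ (δs : ℝ) (p : unitInterval), (p : ℝ) < 1 →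
      ∀ (G : SimpleGraph V) [G.LocallyFinite], (∀ x, G.degree x ≤ Δ) →
      ∀ (W : Sym2 V → unitInterval) (s : Fin (n + 1) → TStep G) (T' : Fin (n + 1) → Finset V) (η : ℝ),
      (∀ i : Fin (n + 1), (s i).L.o = (s 0).L.o) →
      (∀ i : Fin n, T' (Fin.castSucc i) ⊆ (s i.succ).L.X 0) →
      (∀ i : Fin (n + 1), T' i ⊆ (s i).T) →
      (∀ i : Fin (n + 1), (s i).KitsAtF W p Δ δ) →
      (∀ i : Fin (n + 1), (prodBernoulli W).real (⋃ t ∈ (s i).T \ T' i, openConn (s 0).L.o t) ≤ η) →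
      1 - δs < (prodBernoulli W).real (s 0).L.reachB →
        1 - (δs + (n + 1 : ℕ) * (C * δ + η)) < (prodBernoulli W).real (⋃ t ∈ T' (Fin.last n), openConn (s 0).L.o t) :=
  (additiveTargetPropertyUF_KN (V := V) (Δ := Δ)).chain_edge_from_source

end KNLevels

end Transplant

end Summit.CriticalPhenomena.PercolationContinuityZ3.Theorems

end
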